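import Literature.AlgebraicGeometry.Frobenioids.MotivatingExamplesSubProofs
import Literature.AlgebraicGeometry.Frobenioids.MotivatingExamplesSubProofs2
import Literature.AlgebraicGeometry.Frobenioids.ArithmeticDivisorsPrimes
import Literature.AlgebraicGeometry.Frobenioids.ArithmeticFrobenioidHypotheses
import HarnessLib

/-!
# Frobenioids I, Theorem 6.4 (iii) AS TYPED from divisor-level data: rows T64iii/L01 (inline), L03, L07 (PROOFS)

Mochizuki, *The geometry of Frobenioids I: the general theory*, Kyushu J. Math. **62** (2008) 293–400, §6,
Theorem 6.4 (iii), statement pp. 114–115, proof p. 116 l. 4–16 [cite: MochizukiFrdI2008, Thm. 6.4 (iii) p.114]: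
"Suppose that `Ψ^rlf` arises from an equivalence of categories `Ψ′ : (C₁^pf)^un-tr ⥲ (C₂^pf)^un-tr`. Then
`deg(Ψ^rlf) ∈ ℚ_{>0}`; … the bijection `V(L₁) ⥲ Prime(Φ₁(L₁)) ⥲ Prime(Φ₂(L₂)) ⥲ V(L₂)` induced by `Ψ′`
[cf. (i); Corollary 4.11, (iii)] maps a valuation lying over `v₀ ∈ V(ℚ)` to a valuation lying over `v₀`."

abc-iut cell, sub-DAG `plan/L1/SUBDAG-FrdI-Thm64.md`, rows **T64iii/L01** (the `(Ψ^pf)^un-tr`-induced monoid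
isomorphism `Φ₁^pf(L₁) ⥲ Φ₂^pf(L₂)` of Cor. 4.11 (iii) with its two compatibilities — here as INLINE BINDERS at the
level of the divisor monoids `Φ_i(L_i)^pf = (effective arithmetic divisors)^pf`, no new definition), **T64iii/L03**
(the degree relation at generators, DERIVED: the isomorphism carries the generator class `[δ_{w₁}]` to a positive
RATIONAL multiple `(a/n)·[δ_{w₂}]`, whence `deg · log N(w₁) = (a/n) · log N(w₂)`), and **T64iii/L07** (composition
into the typed schema `Thm64iii`, seat abc-iut-L1-t3), over the landed numeric core (rows L02/L04/L05/L06: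
`Thm64iii_L02_commensurability_holds`, `Thm64iii_L06_degRational_holds`, seats abc-iut-L1-t1 / L6-t10).

The binders are exactly what Cor. 4.11 (iii) / Thm. 4.2 (ii) (prime compatibility) and Thm. 6.4 (ii) (the
degree of `Ψ^rlf`, read on divisors through the comparison functors `u_i`) provide at THE constructions:
* `θ : Φ₁(L₁)^pf ≃* Φ₂(L₂)^pf`;
* `hθπ`: `θ` carries the ray `{x ≼ [δ_v]}` of the prime of a place `v` onto the ray of `placeMap v` (Cor. 4.11 (iii)
  compatibility with `Ψ^Prime`; `Prime(Φ(L)) = V(L)`, Ex. 6.3, `Ex63_primes_holds`);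
* `d_i : Φ_i(L_i)^pf → ℝ` extending `deg^arith_{L_i}`, and `hθd : deg^arith(θ x) = deg · deg^arith(x)` (Thm. 6.4 (ii)).
The separation "archimedean ↔ archimedean, finite ↔ finite" is print's `v₀ = ∞` case, proved by COMMENSURABILITY
(row L02): in the ray of a finite place any two non-trivial elements have a common power, in the ray of an infinite
place (`≅ ℝ_{≥0}`) not — and `θ` preserves common powers.  Nothing here is specific to the abc programme.
-/

noncomputable section

namespace Literature.AlgebraicGeometry.Frobenioids

open NumberField Function

universe u v

namespace EffArithDivisor

variable {L : Type} [Field L] [NumberField L]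

/-! ### §1 The rays of `Φ(L)^pf` at a place -/

/-- `(D)^{1/n} = 1` in `Φ(L)^pf` iff `D = 0` (`Φ(L)` is sharp). [cite: MochizukiFrdI2008, §0 p.11] -/
theorem mk_ofAdd_eq_one_iff {D : EffArithDivisor L} {n : ℕ+} :
    Perfection.mk (Multiplicative.ofAdd D) n = 1 ↔ D = 0 :=
  (Perfection.mk_eq_one_iff_of_isSharp (EffArithDivisor.isDivisorial L).isSharp).trans
    ⟨fun h => Multiplicative.ofAdd.injective h, fun h => by rw [h]; rfl⟩

/-- **The ray of the prime of `v` in `Φ(L)^pf`**: `D^{1/n} ≼ [δ_v]` iff `D` is supported within `{v}`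
(Ex. 6.3: `≼`-classes of `Φ(L)` are classified by supports). [cite: MochizukiFrdI2008, Ex. 6.3 p.113] -/
theorem mk_precsim_of_single_iff {D : EffArithDivisor L} {n : ℕ+} {v : Places L} :
    Precsim (Perfection.mk (Multiplicative.ofAdd D) n)
        (Perfection.of _ (Multiplicative.ofAdd (EffArithDivisor.single L v))) ↔ psupp D ⊆ {v} := by
  rw [← psupp_single v, ← precsim_iff_psupp_subset,
    ← Perfection.of_precsim_of_iff (M := Multiplicative (EffArithDivisor L))]
  exact ⟨fun h => (Perfection.mk_precsim_of _ n).2.trans h, fun h => (Perfection.mk_precsim_of _ n).1.trans h⟩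

/-- A divisor supported within a finite place `w` is `a · δ_w`, `a = D(w)`. [cite: MochizukiFrdI2008, Ex. 6.3 p.113] -/
theorem eq_of_psupp_subset_inr {D : EffArithDivisor L} {w : FinitePlace L} (h : psupp D ⊆ {Sum.inr w}) :
    D = (Finsupp.single w (D.1 w), 0) := by
  classical
  refine Prod.ext (Finsupp.ext fun v => ?_) (funext fun u => ?_)
  · by_cases hv : v = w
    · subst hv
      simp
    · have hn : (Sum.inr v : Places L) ∉ psupp D := fun hm => hv (Sum.inr.inj (h hm))
      rw [inr_mem_psupp, not_not] at hn
      rw [hn, Finsupp.single_apply, if_neg (Ne.symm hv)]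
  · have hn : (Sum.inl u : Places L) ∉ psupp D := fun hm => Sum.inl_ne_inr (h hm)
    rw [inl_mem_psupp, not_not] at hn
    rw [hn]
    rfl

/-- The divisor `a · δ_w` at a finite place as a power of `δ_w`. [cite: MochizukiFrdI2008, Ex. 6.3 p.113] -/
theorem ofAdd_single_inr_pow (w : FinitePlace L) (a : ℕ) :
    Multiplicative.ofAdd (EffArithDivisor.single L (Sum.inr w)) ^ a =
      Multiplicative.ofAdd ((Finsupp.single w a, 0) : EffArithDivisor L) := by
  classical
  rw [← ofAdd_nsmul]
  congr 1
  refine Prod.ext (Finsupp.ext fun v => ?_) (funext fun u => ?_)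
  · simp [EffArithDivisor.single]
  · simp [EffArithDivisor.single]

/-- **Commensurability in the ray of a FINITE place** (row T64iii/L02, first clause, realised in `Φ(L)^pf`): two
non-trivial elements `≼ [δ_w]` have a common power. [cite: MochizukiFrdI2008, Thm. 6.4 (iii) p.115] -/
theorem exists_pow_eq_pow_of_precsim_inr {w : FinitePlace L}
    {y y' : Perfection (Multiplicative (EffArithDivisor L))}
    (hy : Precsim y (Perfection.of _ (Multiplicative.ofAdd (EffArithDivisor.single L (Sum.inr w)))))
    (hy' : Precsim y' (Perfection.of _ (Multiplicative.ofAdd (EffArithDivisor.single L (Sum.inr w)))))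
    (h1 : y ≠ 1) (h1' : y' ≠ 1) : ∃ m n : ℕ, 0 < m ∧ 0 < n ∧ y ^ m = y' ^ n := by
  obtain ⟨⟨x, k⟩, rfl⟩ := Perfection.mk_surjective y
  obtain ⟨⟨x', k'⟩, rfl⟩ := Perfection.mk_surjective y'
  obtain ⟨D, rfl⟩ := Multiplicative.ofAdd.surjective x
  obtain ⟨D', rfl⟩ := Multiplicative.ofAdd.surjective x'
  dsimp only at hy hy' h1 h1' ⊢
  have hD := eq_of_psupp_subset_inr (mk_precsim_of_single_iff.mp hy)
  have hD' := eq_of_psupp_subset_inr (mk_precsim_of_single_iff.mp hy')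
  generalize D.1 w = a at hD
  generalize D'.1 w = a' at hD'
  subst hD hD'
  have ha : a ≠ 0 := fun h0 => h1 (mk_ofAdd_eq_one_iff.mpr (by rw [h0]; simp))
  have ha' : a' ≠ 0 := fun h0 => h1' (mk_ofAdd_eq_one_iff.mpr (by rw [h0]; simp))
  refine ⟨(k : ℕ) * a', (k' : ℕ) * a, Nat.mul_pos k.pos (Nat.pos_of_ne_zero ha'),
    Nat.mul_pos k'.pos (Nat.pos_of_ne_zero ha), ?_⟩
  rw [pow_mul, Perfection.mk_pow_self, pow_mul, Perfection.mk_pow_self, ← MonoidHom.map_pow,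
    ← MonoidHom.map_pow, ← ofAdd_single_inr_pow, ← ofAdd_single_inr_pow, ← pow_mul, ← pow_mul, mul_comm a a']

/-- **Incommensurability in the ray of an INFINITE place** (row T64iii/L02, second clause, realised in `Φ(L)^pf`):
there are two non-trivial elements `≼ [δ_u]` with NO common power (the ray is `ℝ_{≥0}`).
[cite: MochizukiFrdI2008, Thm. 6.4 (iii) p.115] -/
theorem exists_incommensurable_of_inl (u : InfinitePlace L) :
    ∃ z z' : Perfection (Multiplicative (EffArithDivisor L)),
      Precsim z (Perfection.of _ (Multiplicative.ofAdd (EffArithDivisor.single L (Sum.inl u)))) ∧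
      Precsim z' (Perfection.of _ (Multiplicative.ofAdd (EffArithDivisor.single L (Sum.inl u)))) ∧
      z ≠ 1 ∧ z' ≠ 1 ∧ ∀ m n : ℕ, 0 < m → 0 < n → z ^ m ≠ z' ^ n := by
  classical
  obtain ⟨s, t, hs, ht, hst⟩ : ∃ s t : ℝ, 0 < s ∧ 0 < t ∧ ∀ m n : ℕ, 0 < m → 0 < n → (m : ℝ) * s ≠ n * t := by
    by_contra hcon
    apply Thm64iii_L02_commensurability_holds.2
    intro x y hx hy
    by_contra hxy
    exact hcon ⟨x, y, hx, hy, fun m n hm hn e => hxy ⟨m, n, hm, hn, e⟩⟩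
  -- the divisors `r · δ_u` (`r = s, t`): supported within `{u}`, non-zero, with `u`-coordinate `r`
  have hsupp : ∀ r : NNReal,
      psupp ((0, fun u' => if u' = u then r else 0) : EffArithDivisor L) ⊆ {Sum.inl u} := by
    intro r p hp
    rcases p with u' | v
    · by_cases hu : u' = u
      · rw [hu]; rfl
      · exact absurd (by change (if u' = u then r else 0) = 0; rw [if_neg hu]) hp
    · exact absurd rfl hp
  have hne : ∀ r : NNReal, r ≠ 0 →
      Perfection.of _ (Multiplicative.ofAdd ((0, fun u' => if u' = u then r else 0) : EffArithDivisor L)) ≠ 1 := by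
    intro r hr h
    rw [Perfection.of_apply, mk_ofAdd_eq_one_iff] at h
    have h' := congrArg (fun D : EffArithDivisor L => D.2 u) h
    have e1 : ((0, fun u' => if u' = u then r else 0) : EffArithDivisor L).2 u = r := if_pos rfl
    rw [e1] at h'
    exact hr h'
  have snd_nsmul : ∀ (k : ℕ) (D : EffArithDivisor L), (k • D).2 u = k • D.2 u := fun k D => by
    induction k with
    | zero => simp
    | succ k ih => rw [succ_nsmul, succ_nsmul, Prod.snd_add, Pi.add_apply, ih]
  refine ⟨Perfection.of _ (Multiplicative.ofAdd ((0, fun u' => if u' = u then ⟨s, hs.le⟩ else 0) : EffArithDivisor L)),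
    Perfection.of _ (Multiplicative.ofAdd ((0, fun u' => if u' = u then ⟨t, ht.le⟩ else 0) : EffArithDivisor L)),
    ?_, ?_, hne _ (fun h => hs.ne' (congrArg NNReal.toReal h)), hne _ (fun h => ht.ne' (congrArg NNReal.toReal h)),
    fun m n hm hn e => ?_⟩
  · rw [Perfection.of_apply]; exact mk_precsim_of_single_iff.mpr (hsupp _)
  · rw [Perfection.of_apply]; exact mk_precsim_of_single_iff.mpr (hsupp _)
  · rw [← MonoidHom.map_pow, ← MonoidHom.map_pow, ← ofAdd_nsmul, ← ofAdd_nsmul, Perfection.of_eq_of_iff] at e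
    obtain ⟨N, hN⟩ := e
    rw [← ofAdd_nsmul, ← ofAdd_nsmul] at hN
    have hN' : ((N : ℕ) • m • ((0, fun u' => if u' = u then (⟨s, hs.le⟩ : NNReal) else 0) : EffArithDivisor L)).2 u =
        ((N : ℕ) • n • ((0, fun u' => if u' = u then (⟨t, ht.le⟩ : NNReal) else 0) : EffArithDivisor L)).2 u :=
      congrArg (fun D : EffArithDivisor L => D.2 u) (Multiplicative.ofAdd.injective hN)
    rw [snd_nsmul, snd_nsmul, snd_nsmul, snd_nsmul] at hN'
    have e1 : ((0, fun u' => if u' = u then (⟨s, hs.le⟩ : NNReal) else 0) : EffArithDivisor L).2 u = ⟨s, hs.le⟩ :=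
      if_pos rfl
    have e2 : ((0, fun u' => if u' = u then (⟨t, ht.le⟩ : NNReal) else 0) : EffArithDivisor L).2 u = ⟨t, ht.le⟩ :=
      if_pos rfl
    rw [e1, e2] at hN'
    have hR : ((N : ℕ) • m • s : ℝ) = (N : ℕ) • n • t := by
      have h := congrArg NNReal.toReal hN'
      rw [NNReal.coe_nsmul, NNReal.coe_nsmul, NNReal.coe_nsmul, NNReal.coe_nsmul] at h
      exact h
    simp only [nsmul_eq_mul] at hR
    apply hst ((N : ℕ) * m) ((N : ℕ) * n) (Nat.mul_pos N.pos hm) (Nat.mul_pos N.pos hn)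
    rw [Nat.cast_mul, Nat.cast_mul]
    linear_combination hR

/-! ### §2 The arithmetic degree on `Φ(L)^pf` -/

/-- `deg^arith(δ_w) = log N(w)` for a finite place `w`. [cite: MochizukiFrdI2008, Ex. 6.3 p.114] -/
theorem arithDegree_single_inr (w : FinitePlace L) (a : ℕ) :
    arithDegree L (toArithDivisor L ((Finsupp.single w a, 0) : EffArithDivisor L)) = a * logNorm w := by
  classical
  have h : toArithDivisor L ((Finsupp.single w a, 0) : EffArithDivisor L) = (Finsupp.single w (a : ℤ), 0) := by
    refine Prod.ext (Finsupp.ext fun v => ?_) (funext fun u => ?_)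
    · rw [toArithDivisor_fst, Finsupp.single_apply, Finsupp.single_apply]
      split_ifs <;> simp
    · rw [toArithDivisor_snd]
      simp
  rw [h, arithDegree_single]
  simp [logNorm]

/-- A degree `d : Φ(L)^pf → ℝ` extending `deg^arith` takes the value `deg^arith(D)/n` on `D^{1/n}`.
[cite: MochizukiFrdI2008, Ex. 6.3 p.113] -/
theorem toAdd_apply_mk_eq (d : Perfection (Multiplicative (EffArithDivisor L)) →* Multiplicative ℝ)
    (hd : ∀ D : EffArithDivisor L,
      Multiplicative.toAdd (d (Perfection.of _ (Multiplicative.ofAdd D))) = arithDegree L (toArithDivisor L D))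
    (D : EffArithDivisor L) (n : ℕ+) :
    Multiplicative.toAdd (d (Perfection.mk (Multiplicative.ofAdd D) n)) = arithDegree L (toArithDivisor L D) / n := by
  have h := congrArg (fun x => Multiplicative.toAdd (d x)) (Perfection.mk_pow_self (Multiplicative.ofAdd D) n)
  rw [map_pow, toAdd_pow, hd, nsmul_eq_mul] at h
  rw [eq_div_iff (by exact_mod_cast n.pos.ne'), mul_comm]
  exact h

end EffArithDivisor

/-! ### §3 Theorem 6.4 (iii) from the divisor-level data (rows T64iii/L03, L07) -/

open EffArithDivisor

/-- **Theorem 6.4 (iii), numeric conclusion from the divisor-level transport** (rows T64iii/L01 as inline binders,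
L03 derived, L02/L06 consumed): for number fields `L₁, L₂`, `deg > 0`, a bijection of places `placeMap`, a monoid
isomorphism `θ : Φ₁(L₁)^pf ⥲ Φ₂(L₂)^pf` carrying the ray of each place `v` onto the ray of `placeMap v`, and
degrees `d_i` extending `deg^arith_{L_i}` with `d₂ ∘ θ = deg · d₁`: `deg ∈ ℚ_{>0}`, `placeMap` maps archimedean
places to archimedean places, and finite places to finite places of the same residue characteristic.
[cite: MochizukiFrdI2008, Thm. 6.4 (iii) p.114] -/
theorem thm64iii_core (L₁ : Type) [Field L₁] [NumberField L₁] (L₂ : Type) [Field L₂] [NumberField L₂]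
    (deg : ℝ) (hdeg : 0 < deg) (placeMap : Places L₁ ≃ Places L₂)
    (θ : Perfection (Multiplicative (EffArithDivisor L₁)) ≃* Perfection (Multiplicative (EffArithDivisor L₂)))
    (hθπ : ∀ (v : Places L₁) (x : Perfection (Multiplicative (EffArithDivisor L₁))),
      Precsim x (Perfection.of _ (Multiplicative.ofAdd (EffArithDivisor.single L₁ v))) ↔
        Precsim (θ x) (Perfection.of _ (Multiplicative.ofAdd (EffArithDivisor.single L₂ (placeMap v)))))
    (d₁ : Perfection (Multiplicative (EffArithDivisor L₁)) →* Multiplicative ℝ)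
    (d₂ : Perfection (Multiplicative (EffArithDivisor L₂)) →* Multiplicative ℝ)
    (hd₁ : ∀ D, Multiplicative.toAdd (d₁ (Perfection.of _ (Multiplicative.ofAdd D))) = arithDegree L₁ (toArithDivisor L₁ D))
    (hd₂ : ∀ D, Multiplicative.toAdd (d₂ (Perfection.of _ (Multiplicative.ofAdd D))) = arithDegree L₂ (toArithDivisor L₂ D))
    (hθd : ∀ x, Multiplicative.toAdd (d₂ (θ x)) = deg * Multiplicative.toAdd (d₁ x)) :
    (∃ q : ℚ, 0 < q ∧ deg = q) ∧
      (∀ u : InfinitePlace L₁, ∃ u' : InfinitePlace L₂, placeMap (Sum.inl u) = Sum.inl u') ∧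
      ∀ w : FinitePlace L₁, ∃ w' : FinitePlace L₂,
        placeMap (Sum.inr w) = Sum.inr w' ∧ residueChar w = residueChar w' := by
  classical
  have hθpow : ∀ (x : Perfection (Multiplicative (EffArithDivisor L₁))) (k : ℕ), θ (x ^ k) = θ x ^ k :=
    fun x k => θ.toMonoidHom.map_pow x k
  -- (a) finite places go to finite places: a finite ray is commensurable, an infinite ray is not
  have hfin : ∀ w : FinitePlace L₁, ∃ w' : FinitePlace L₂, placeMap (Sum.inr w) = Sum.inr w' := by
    intro w
    rcases hv : placeMap (Sum.inr w) with u' | w'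
    · exfalso
      obtain ⟨z, z', hz, hz', hz1, hz1', hzz⟩ := exists_incommensurable_of_inl (L := L₂) u'
      have hy : Precsim (θ.symm z) (Perfection.of _ (Multiplicative.ofAdd (EffArithDivisor.single L₁ (Sum.inr w)))) := by
        rw [hθπ, hv, MulEquiv.apply_symm_apply]; exact hz
      have hy' : Precsim (θ.symm z') (Perfection.of _ (Multiplicative.ofAdd (EffArithDivisor.single L₁ (Sum.inr w)))) := by
        rw [hθπ, hv, MulEquiv.apply_symm_apply]; exact hz'
      obtain ⟨m, n, hm, hn, e⟩ := exists_pow_eq_pow_of_precsim_inr hy hy'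
        (fun h => hz1 (by rw [← MulEquiv.apply_symm_apply θ z, h]; exact θ.map_one))
        (fun h => hz1' (by rw [← MulEquiv.apply_symm_apply θ z', h]; exact θ.map_one))
      have e' := congrArg θ e
      rw [hθpow, hθpow, MulEquiv.apply_symm_apply, MulEquiv.apply_symm_apply] at e'
      exact hzz m n hm hn e'
    · exact ⟨w', rfl⟩
  -- (b) infinite places go to infinite places
  have hinf : ∀ u : InfinitePlace L₁, ∃ u' : InfinitePlace L₂, placeMap (Sum.inl u) = Sum.inl u' := by
    intro u
    rcases hv : placeMap (Sum.inl u) with u' | w'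
    · exact ⟨u', rfl⟩
    · exfalso
      obtain ⟨z, z', hz, hz', hz1, hz1', hzz⟩ := exists_incommensurable_of_inl (L := L₁) u
      have hy : Precsim (θ z) (Perfection.of _ (Multiplicative.ofAdd (EffArithDivisor.single L₂ (Sum.inr w')))) := by
        rw [← hv, ← hθπ]; exact hz
      have hy' : Precsim (θ z') (Perfection.of _ (Multiplicative.ofAdd (EffArithDivisor.single L₂ (Sum.inr w')))) := by
        rw [← hv, ← hθπ]; exact hz'
      obtain ⟨m, n, hm, hn, e⟩ := exists_pow_eq_pow_of_precsim_inr hy hy'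
        (fun h => hz1 (θ.map_eq_one_iff.mp h)) (fun h => hz1' (θ.map_eq_one_iff.mp h))
      rw [← hθpow, ← hθpow] at e
      exact hzz m n hm hn (θ.injective e)
  -- (c) the induced bijection of finite places
  choose f hf using hfin
  have hfin' : ∀ w' : FinitePlace L₂, ∃ w : FinitePlace L₁, placeMap.symm (Sum.inr w') = Sum.inr w := by
    intro w'
    rcases hv : placeMap.symm (Sum.inr w') with u | w
    · exfalso
      obtain ⟨u', hu'⟩ := hinf u
      have := placeMap.apply_symm_apply (Sum.inr w')
      rw [hv, hu'] at this
      exact Sum.inl_ne_inr this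
    · exact ⟨w, rfl⟩
  choose g hg using hfin'
  have hgf : ∀ w, g (f w) = w := fun w => by
    apply Sum.inr.inj
    rw [← hg, ← hf, Equiv.symm_apply_apply]
  have hfg : ∀ w', f (g w') = w' := fun w' => by
    apply Sum.inr.inj
    rw [← hf, ← hg, Equiv.apply_symm_apply]
  let π : FinitePlace L₁ ≃ FinitePlace L₂ := ⟨f, g, hgf, hfg⟩
  -- (d) the degree relation at generators (row T64iii/L03)
  have hL03 : ∀ w, ∃ q : ℚ, 0 < q ∧ deg * logNorm w = q * logNorm (f w) := by
    intro w
    -- `θ [δ_w] ≼ [δ_{π w}]`, so `θ [δ_w] = (a · δ_{π w})^{1/n}` with `a ≠ 0`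
    have hx : Precsim (θ (Perfection.of _ (Multiplicative.ofAdd (EffArithDivisor.single L₁ (Sum.inr w)))))
        (Perfection.of _ (Multiplicative.ofAdd (EffArithDivisor.single L₂ (Sum.inr (f w))))) := by
      rw [← hf, ← hθπ]; exact precsim_refl _
    obtain ⟨⟨x, n⟩, hxn⟩ := Perfection.mk_surjective
      (θ (Perfection.of _ (Multiplicative.ofAdd (EffArithDivisor.single L₁ (Sum.inr w)))))
    obtain ⟨D, rfl⟩ := Multiplicative.ofAdd.surjective x
    change Perfection.mk (Multiplicative.ofAdd D) n = _ at hxn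
    rw [← hxn] at hx
    have hD := eq_of_psupp_subset_inr (mk_precsim_of_single_iff.mp hx)
    have ha : D.1 (f w) ≠ 0 := by
      intro h0
      have h1 : Perfection.mk (Multiplicative.ofAdd D) n = 1 := mk_ofAdd_eq_one_iff.mpr (by rw [hD, h0]; simp)
      rw [hxn] at h1
      have h2 := θ.map_eq_one_iff.mp h1
      rw [Perfection.of_apply, mk_ofAdd_eq_one_iff] at h2
      have h3 := congrArg (fun E : EffArithDivisor L₁ => E.1 w) h2
      simp [EffArithDivisor.single] at h3
    refine ⟨(D.1 (f w) : ℚ) / (n : ℕ), div_pos (by exact_mod_cast Nat.pos_of_ne_zero ha) (by exact_mod_cast n.pos), ?_⟩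
    have e := hθd (Perfection.of _ (Multiplicative.ofAdd (EffArithDivisor.single L₁ (Sum.inr w))))
    rw [← hxn, toAdd_apply_mk_eq d₂ hd₂, hd₁, hD, arithDegree_single_inr] at e
    rw [show EffArithDivisor.single L₁ (Sum.inr w) = ((Finsupp.single w 1, 0) : EffArithDivisor L₁) from rfl,
      arithDegree_single_inr, Nat.cast_one, one_mul] at e
    rw [← e]
    push_cast
    ring
  -- (e) the numeric core (row T64iii/L06)
  obtain ⟨hq, hchar⟩ := Thm64iii_L06_degRational_holds L₁ L₂ deg π hdeg hL03
  exact ⟨hq, hinf, fun w => ⟨f w, hf w, (hchar w).symm⟩⟩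

variable {F₁ : Type} [Field F₁] [NumberField F₁] {K₁ : Type} [Field K₁] [Algebra F₁ K₁]
variable {F₂ : Type} [Field F₂] [NumberField F₂] {K₂ : Type} [Field K₂] [Algebra F₂ K₂]
variable {Rlf₁ : Type u} [CategoryTheory.Category.{v} Rlf₁] {Rlf₂ : Type u} [CategoryTheory.Category.{v} Rlf₂]
variable (R₁ : ArithRealification (F := F₁) (K := K₁) Rlf₁) (R₂ : ArithRealification (F := F₂) (K := K₂) Rlf₂)

/-- **Theorem 6.4 (iii) AS TYPED (`Thm64iii`), from the divisor-level transport** (row T64iii/L07 = composition):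
the schema of seat abc-iut-L1-t3 holds for every equivalence `Ψ'` and bijection of places `placeMap`, GIVEN the
`(Ψ^pf)^un-tr`-induced monoid isomorphism `θ : Φ₁(L₁)^pf ⥲ Φ₂(L₂)^pf` (Cor. 4.11 (iii)) carrying the prime ray of
`v` onto that of `placeMap v` and scaling the arithmetic degree by the degree `deg` of `Ψ^rlf` (Thm. 6.4 (ii), read
on divisors through the comparison functors `u_i`) — the inline binders that THE constructions supply.
[cite: MochizukiFrdI2008, Thm. 6.4 (iii) p.114] -/
theorem thm64iii_of_divisorTransport (Ψ : Rlf₁ ≌ Rlf₂)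
    (picMap : ∀ A : Rlf₁, R₁.Pic A ≃+ R₂.Pic (Ψ.functor.obj A)) (deg : ℝ)
    {U₁ : Type u} [CategoryTheory.Category.{v} U₁] {U₂ : Type u} [CategoryTheory.Category.{v} U₂]
    (u₁ : CategoryTheory.Functor U₁ Rlf₁) (u₂ : CategoryTheory.Functor U₂ Rlf₂) (Ψ' : U₁ ≌ U₂) (A₁ : U₁)
    (placeMap : Places (R₁.ops.base.obj (u₁.obj A₁)).L ≃
      Places (R₂.ops.base.obj (u₂.obj (Ψ'.functor.obj A₁))).L)
    (θ : Perfection (Multiplicative (EffArithDivisor (R₁.ops.base.obj (u₁.obj A₁)).L)) ≃*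
      Perfection (Multiplicative (EffArithDivisor (R₂.ops.base.obj (u₂.obj (Ψ'.functor.obj A₁))).L)))
    (hθπ : ∀ (v : Places (R₁.ops.base.obj (u₁.obj A₁)).L) x,
      Precsim x (Perfection.of _ (Multiplicative.ofAdd (EffArithDivisor.single _ v))) ↔
        Precsim (θ x) (Perfection.of _ (Multiplicative.ofAdd (EffArithDivisor.single _ (placeMap v)))))
    (d₁ : Perfection (Multiplicative (EffArithDivisor (R₁.ops.base.obj (u₁.obj A₁)).L)) →* Multiplicative ℝ)
    (d₂ : Perfection (Multiplicative (EffArithDivisor (R₂.ops.base.obj (u₂.obj (Ψ'.functor.obj A₁))).L)) →*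
      Multiplicative ℝ)
    (hd₁ : ∀ D, Multiplicative.toAdd (d₁ (Perfection.of _ (Multiplicative.ofAdd D))) = arithDegree _ (toArithDivisor _ D))
    (hd₂ : ∀ D, Multiplicative.toAdd (d₂ (Perfection.of _ (Multiplicative.ofAdd D))) = arithDegree _ (toArithDivisor _ D))
    (hθd : ∀ x, Multiplicative.toAdd (d₂ (θ x)) = deg * Multiplicative.toAdd (d₁ x)) :
    Thm64iii R₁ R₂ Ψ picMap deg u₁ u₂ Ψ' A₁ placeMap := by
  intro hT _
  obtain ⟨hq, hinf, hfin⟩ := thm64iii_core _ _ deg hT.1 placeMap θ hθπ d₁ d₂ hd₁ hd₂ hθd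
  exact ⟨hq, hinf, fun w => hfin w⟩

end Literature.AlgebraicGeometry.Frobenioids

end
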